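import Mathlib
import Literature.Combinatorics.AssociationSchemes.Basic

/-!
# MatrixMultiplication / CommutativeSchemes — crux `CommutativeRealization`, stub 2:
translation schemes are commutative

Route `CommutativeSchemes`, crux `CommutativeRealization` (stmt-MatrixMultiplication-9462, Cohn–Umans 2013
Conjecture 21 in ε-form), line `Lines/birth.lean` (translation schemes). This file proves the registered stub
`stub_translationScheme_isCommutative`: an association scheme `S` on a finite abelian group `H` whose class
map is invariant under simultaneous translation, `S.cls (x + w) (y + w) = S.cls x y`, is commutative
(Brouwer–Cohen–Neumaier, *Distance-Regular Graphs*, §2.10; Cohn–Umans 2013 §4.2 for group schemes).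

Proof: translation invariance gives `S.cls x (x + y - z) = S.cls z y` and `S.cls (x + y - z) y = S.cls x z`,
so the involution `z ↦ x + y - z` of `H` carries `{z | cls x z = a ∧ cls z y = b}` onto
`{z | cls x z = b ∧ cls z y = a}`; the two intersection counts agree by `Finset.card_equiv`.

References: A. E. Brouwer, A. M. Cohen, A. Neumaier, *Distance-Regular Graphs*, Springer 1989, §2.10;
H. Cohn, C. Umans, *Fast matrix multiplication using coherent configurations*, SODA 2013, arXiv:1207.6528, §4.2.
-/

-- the tree's namespace `Summit.MatrixMultiplication.MatrixMultiplication.…` repeats a component by design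
set_option linter.dupNamespace false

namespace Summit.MatrixMultiplication.MatrixMultiplication.Theorems

open Finset Function Literature.Combinatorics.AssociationSchemes

/-- **Translation schemes are commutative** (Brouwer–Cohen–Neumaier §2.10; Cohn–Umans 2013 §4.2 for group
schemes). If the class map of an association scheme `S` on a finite abelian group `H` is invariant under
simultaneous translation, then the involution `z ↦ x + y - z` of `H` exchanges the solution sets
`{z | cls x z = a ∧ cls z y = b}` and `{z | cls x z = b ∧ cls z y = a}`, so `p^c_{ab} = p^c_{ba}`.
[cite: CohnUmans2013, §4.2] -/
theorem stub_translationScheme_isCommutative :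
    ∀ (H : Type) [AddCommGroup H] [Fintype H] (r : ℕ) (S : AssociationScheme H (Fin r)),
      (∀ x y w : H, S.cls (x + w) (y + w) = S.cls x y) → S.IsCommutative := by
  intro H _ _ _ S h a b x y
  -- translation invariance, instantiated at the translations `x - z` and `y - z`
  have e1 : ∀ z : H, S.cls x (x + y - z) = S.cls z y := fun z => by
    have h1 := h z y (x - z)
    rwa [show z + (x - z) = x by abel, show y + (x - z) = x + y - z by abel] at h1
  have e2 : ∀ z : H, S.cls (x + y - z) y = S.cls x z := fun z => by
    have h2 := h x z (y - z)
    rwa [show x + (y - z) = x + y - z by abel, show z + (y - z) = y by abel] at h2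
  -- the involution `z ↦ x + y - z` swaps the two solution sets
  refine Finset.card_equiv (Equiv.mk (fun z : H => x + y - z) (fun z => x + y - z) ?_ ?_) ?_
  · intro z; simp only [sub_sub_cancel]
  · intro z; simp only [sub_sub_cancel]
  · intro z
    simp only [mem_filter, mem_univ, true_and, Equiv.coe_fn_mk]
    rw [e1 z, e2 z]
    exact and_comm

end Summit.MatrixMultiplication.MatrixMultiplication.Theorems
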